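import Mathlib

/-!
# Real-element lifts from rings of integers: the no-wrap-around and trace-positivity engine
(crux `LevelOneGL2Designs`, stmt-MatrixMultiplication-14080, wall stub `stub_tangencySets`;
wall-breaker axis k8/12 "parabola lifts over finite fields", generation 1)

Pohoata's trace-zero parabola lift (arXiv:2607.20422, Prop. 5.1) transports a configuration
built inside the ring of integers of a totally real number field to `𝔽_p` along a degree-one
prime.  Two facts make the transport faithful:

* **no wrap-around**: an algebraic integer `w` that dies modulo the prime and all of whose
  complex conjugates are small is `0` (the prime divides the norm, the norm is small);
* **no square differences**: a non-zero totally real element has `Tr(w²) > 0`.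

This file proves both in a form that avoids the maximal real subfield altogether, so that the
cyclotomic instance `K = ℚ(ζ_r)` (companion files `…CyclotomicLift*`) can work inside
Mathlib's `CyclotomicField r ℚ` and its integral power basis:

* `absNorm_ker_zmod` : the kernel of any ring map `𝓞 K → ZMod p` has absolute norm `p`;
* `sq_dvd_norm_of_mem_two_kernels` : if `w` dies under TWO ring maps `𝓞 K → ZMod p` with
  different kernels then `p² ∣ N_{K/ℚ}(w)` — for a real element of a CM field and a split
  prime this recovers `p ∣ N_{K⁺/ℚ}(w)` without ever mentioning `K⁺`;
* `natAbs_norm_le_pow` : `|N(w)| ≤ B^{[K:ℚ]}` when every conjugate of `w` has modulus `≤ B`;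
* `eq_zero_of_two_kernels` : the no-wrap-around lemma (`|N(w)| < p²` and the above force
  `w = 0`);
* `trace_sq_pos_of_real` : `0 < Tr_{K/ℚ}(w²)` for `w ≠ 0` all of whose conjugates are real.

References: C. Pohoata, *The sharp exponent for the minimal distance problem*,
arXiv:2607.20422 (2026), §5 [bib: Pohoata2026SharpExponentMinimalDistance].
-/

-- justification: the summit/problem path `MatrixMultiplication.MatrixMultiplication` is fixed by the
-- tree layout (D-0017), so the namespace necessarily repeats a component.
set_option linter.dupNamespace false

noncomputable section

open NumberField

namespace Summit.MatrixMultiplication.MatrixMultiplication.Theorems.LevelOneGL2Designs.RealLift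

variable {K : Type*} [Field K] [NumberField K]

/-- The kernel of a ring map from a ring of integers onto `ZMod p` (`p` prime; every ring map into
`ZMod p` is onto) has absolute norm `p`. [elementary] -/
theorem absNorm_ker_zmod {p : ℕ} [Fact p.Prime] (φ : 𝓞 K →+* ZMod p) :
    Ideal.absNorm (RingHom.ker φ) = p := by
  rw [Ideal.absNorm_apply, Submodule.cardQuot_apply]
  have e := RingHom.quotientKerEquivOfSurjective (ZMod.ringHom_surjective φ)
  rw [Nat.card_congr e.toEquiv, Nat.card_zmod]

/-- **Two kernels.**  If an algebraic integer `w` is killed by two ring maps `𝓞 K → ZMod p`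
with *different* kernels, then `p² ∣ N_{K/ℚ}(w)`: the kernels are distinct maximal ideals of
norm `p`, hence coprime, so `w` lies in their product, an ideal of norm `p²`. [elementary] -/
theorem sq_dvd_norm_of_mem_two_kernels {p : ℕ} [Fact p.Prime] (φ φ' : 𝓞 K →+* ZMod p)
    (hne : RingHom.ker φ ≠ RingHom.ker φ') {w : 𝓞 K} (h : φ w = 0) (h' : φ' w = 0) :
    ((p : ℤ) ^ 2) ∣ Algebra.norm ℤ w := by
  have hm : (RingHom.ker φ).IsMaximal :=
    RingHom.ker_isMaximal_of_surjective φ (ZMod.ringHom_surjective φ)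
  have hm' : (RingHom.ker φ').IsMaximal :=
    RingHom.ker_isMaximal_of_surjective φ' (ZMod.ringHom_surjective φ')
  have hcop : RingHom.ker φ ⊔ RingHom.ker φ' = ⊤ := hm.coprime_of_ne hm' hne
  have hmem : w ∈ RingHom.ker φ * RingHom.ker φ' := by
    rw [Ideal.mul_eq_inf_of_coprime hcop]
    exact ⟨(RingHom.mem_ker).mpr h, (RingHom.mem_ker).mpr h'⟩
  have hd := Ideal.absNorm_dvd_norm_of_mem hmem
  rwa [map_mul, absNorm_ker_zmod, absNorm_ker_zmod, ← sq, Nat.cast_pow] at hd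

/-- **Norm bound from conjugate bounds.**  If every complex conjugate of the algebraic integer
`w` has modulus at most `B`, then `|N_{K/ℚ}(w)| ≤ B^{[K:ℚ]}`. [elementary] -/
theorem natAbs_norm_le_pow (w : 𝓞 K) {B : ℝ} (hB : ∀ σ : K →ₐ[ℚ] ℂ, ‖σ (w : K)‖ ≤ B) :
    ((Algebra.norm ℤ w).natAbs : ℝ) ≤ B ^ Module.finrank ℚ K := by
  have h1 : ((Algebra.norm ℤ w : ℚ) : ℂ) = ∏ σ : K →ₐ[ℚ] ℂ, σ (w : K) := by
    rw [Algebra.coe_norm_int]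
    exact Algebra.norm_eq_prod_embeddings ℚ ℂ (w : K)
  have h2 : ((Algebra.norm ℤ w).natAbs : ℝ) = ‖((Algebra.norm ℤ w : ℚ) : ℂ)‖ := by
    rw [Complex.norm_ratCast, Nat.cast_natAbs, Rat.cast_intCast, Int.cast_abs]
  rw [h2, h1, norm_prod]
  calc ∏ σ : K →ₐ[ℚ] ℂ, ‖σ (w : K)‖ ≤ ∏ _σ : K →ₐ[ℚ] ℂ, B :=
        Finset.prod_le_prod (fun _ _ => norm_nonneg _) (fun σ _ => hB σ)
    _ = B ^ Module.finrank ℚ K := by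
        rw [Finset.prod_const, Finset.card_univ, AlgHom.card]

/-- **No wrap-around.**  An algebraic integer killed by two ring maps `𝓞 K → ZMod p` with
different kernels and with `|N_{K/ℚ}(w)| < p²` is zero. [elementary] -/
theorem eq_zero_of_two_kernels {p : ℕ} [Fact p.Prime] (φ φ' : 𝓞 K →+* ZMod p)
    (hne : RingHom.ker φ ≠ RingHom.ker φ') {w : 𝓞 K} (h : φ w = 0) (h' : φ' w = 0)
    (hlt : (Algebra.norm ℤ w).natAbs < p ^ 2) : w = 0 := by
  have hd := sq_dvd_norm_of_mem_two_kernels φ φ' hne h h'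
  have h0 : Algebra.norm ℤ w = 0 := by
    refine Int.eq_zero_of_dvd_of_natAbs_lt_natAbs hd ?_
    simpa [Int.natAbs_pow] using hlt
  exact Algebra.norm_eq_zero_iff.mp h0

omit [NumberField K] in
/-- The ring maps `𝓞 K → ZMod p` have different kernels as soon as some algebraic integer is
killed by one and not by the other. [elementary] -/
theorem ker_ne_ker_of_apply {p : ℕ} (φ φ' : 𝓞 K →+* ZMod p) {z : 𝓞 K} (h : φ z = 0)
    (h' : φ' z ≠ 0) : RingHom.ker φ ≠ RingHom.ker φ' := by
  intro hker
  have : z ∈ RingHom.ker φ' := hker ▸ (RingHom.mem_ker).mpr h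
  exact h' ((RingHom.mem_ker).mp this)

/-- **Trace positivity for real elements.**  If every complex conjugate of `w ∈ K` is real
(`w` lies in the maximal real subfield) and `w ≠ 0`, then `Tr_{K/ℚ}(w²) > 0`: the trace is the
sum over the `[K:ℚ] ≥ 1` embeddings `σ` of the squares of the non-zero reals `σ(w)`. [elementary] -/
theorem trace_sq_pos_of_real {w : K} (hreal : ∀ σ : K →ₐ[ℚ] ℂ, starRingEnd ℂ (σ w) = σ w)
    (hw : w ≠ 0) : 0 < Algebra.trace ℚ K (w ^ 2) := by
  have h := trace_eq_sum_embeddings ℂ (K := ℚ) (L := K) (x := w ^ 2)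
  -- each `σ w` is a real number `x σ`
  have hx : ∀ σ : K →ₐ[ℚ] ℂ, σ w = ((σ w).re : ℂ) := fun σ =>
    (Complex.conj_eq_iff_re.mp (hreal σ)).symm
  have hsum : (∑ σ : K →ₐ[ℚ] ℂ, σ (w ^ 2)) = ((∑ σ : K →ₐ[ℚ] ℂ, (σ w).re ^ 2 : ℝ) : ℂ) := by
    push_cast
    refine Finset.sum_congr rfl fun σ _ => ?_
    rw [map_pow]
    nth_rewrite 1 [hx σ]
    rfl
  have hpos : 0 < ∑ σ : K →ₐ[ℚ] ℂ, (σ w).re ^ 2 := by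
    have hne : Nonempty (K →ₐ[ℚ] ℂ) := by
      rw [← Fintype.card_pos_iff, AlgHom.card]
      exact Module.finrank_pos
    obtain ⟨σ⟩ := hne
    have hσ : (σ w).re ≠ 0 := by
      intro h0
      have : σ w = 0 := by rw [hx σ, h0]; simp
      exact hw ((map_eq_zero σ).mp this)
    exact lt_of_lt_of_le (by positivity) (Finset.single_le_sum (f := fun τ : K →ₐ[ℚ] ℂ => (τ w).re ^ 2)
      (fun τ _ => sq_nonneg _) (Finset.mem_univ σ))
  rw [hsum] at h
  -- `h : (algebraMap ℚ ℂ) t = ((s : ℝ) : ℂ)` with `s > 0`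
  have h' : ((Algebra.trace ℚ K (w ^ 2) : ℚ) : ℝ) = ∑ σ : K →ₐ[ℚ] ℂ, (σ w).re ^ 2 := by
    have := congrArg Complex.re h
    rwa [Complex.ofReal_re, eq_ratCast, Complex.ratCast_re] at this
  exact_mod_cast h' ▸ hpos

end Summit.MatrixMultiplication.MatrixMultiplication.Theorems.LevelOneGL2Designs.RealLift
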